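import Summits.Schanuel.Schanuel.Theorems.SoloInformedX193Budget
import Summits.Schanuel.Schanuel.Theorems.SoloInformedX193Resultant
import Literature.NumberTheory.Transcendental.GelfondCriterion

/-!
# X193 kernel, layer B (F10b): the laws (PAIR) and (L1) for the pieces of an enemy sequence

Solo-informed Schanuel programme, X193 kernel (DESIGN `work/s213/X193-KERNEL-DESIGN.md`,
Amendment A14).  For `ξ` transcendental and an enemy sequence `R : ℕ → ℤ[X]`, the service
structure `soloX_pieces ξ R` (F8) satisfies, CONDITIONALLY on
`Literature.NumberTheory.Transcendental.Roy2010.prop_3_1` (Roy 2010, Proposition 3.1, used at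
`t = 1` through `soloX_p31_coprime` of F10a), with the common explicit constant
`A(ξ) = 11 + 4 log (1 + ‖ξ‖) + max (0, -log ‖ξ‖)`:

* (PAIR) `soloX_pieces_pairLaw`: two distinct pieces `P ≠ Q` are coprime primitive
  irreducibles, and Proposition 3.1 on the columns `S ⊆ [1, K]` with
  `V (kξ) = max (‖P(kξ)‖/‖P‖, ‖Q(kξ)‖/‖Q‖)` gives
  `Σ_{k ∈ S} min (d_P^k, d_Q^k) ≤ g_Q L_P + g_P L_Q + A(ξ) (g_P + g_Q + |S|)² log (K + 2)`;
* (L1) `soloX_pieces_entryLaw`: for Roy data `R n ∈ RoyAdditiveSmall ξ β σ 0 ν n` (`n ≥ n₀`,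
  `0 < σ ≤ 1`) and a piece `P` not dividing `R_ℓ`, Proposition 3.1 for the coprime pair
  `(P, primPart R_ℓ)` on columns `1 ≤ k ≤ ℓ^σ` with `V (kξ) = max (‖P(kξ)‖/‖P‖, e^{-ℓ^ν})`
  gives `Σ_{k ∈ S} min (d_P^k, ℓ^ν) ≤ C_P(ℓ) + A(ξ) (ℓ + g_P + |S|)² log (ℓ + 2)`.

`soloX_pieces_pair_entry` packages both with `A(ξ) ≥ 0` for the assembly (F12).
-/

namespace Summit.Schanuel.Schanuel.Theorems

open Polynomial UniqueFactorizationMonoid Finset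
open Literature.NumberTheory.Transcendental.Roy2010

/-! ## (PAIR) for the pieces -/

/-- Two distinct pieces are coprime: `gcd P Q = 1` (distinct normalised irreducibles). -/
theorem soloX_pieces_gcd_eq_one {P Q : soloX_pieceSet} (hPQ : P ≠ Q) :
    gcd (P : ℤ[X]) (Q : ℤ[X]) = 1 := by
  rw [(soloX_piece_irreducible P).gcd_eq_one_iff]
  intro hdvd
  apply hPQ
  apply soloX_piece_ext
  have hassoc : Associated (P : ℤ[X]) (Q : ℤ[X]) :=
    (soloX_piece_irreducible P).associated_of_dvd (soloX_piece_irreducible Q) hdvd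
  have h := normalize_eq_normalize hassoc.dvd hassoc.symm.dvd
  rwa [soloX_piece_normalize P, soloX_piece_normalize Q] at h

/-- **(PAIR) for the pieces of an enemy sequence** [conditional on Roy's Proposition 3.1].
For `ξ` transcendental and any `R`, the structure `soloX_pieces ξ R` satisfies the pair law
with the constant `A(ξ) = 11 + 4 log (1 + ‖ξ‖) + max 0 (-log ‖ξ‖)`: for distinct pieces
`P ≠ Q` and columns `S ⊆ [1, K]`,
`Σ_{k ∈ S} min (d_P^k, d_Q^k) ≤ g_Q L_P + g_P L_Q + A(ξ) (g_P + g_Q + |S|)² log (K + 2)`. -/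
theorem soloX_pieces_pairLaw {ξ : ℂ} (hξ : Transcendental ℚ ξ) (hP31 : prop_3_1)
    (R : ℕ → ℤ[X]) :
    soloX_pieces ξ R ∈
      SoloServiceData.pairLaw (11 + 4 * Real.log (1 + ‖ξ‖) + max 0 (-Real.log ‖ξ‖)) := by
  intro P Q hPQ K S hS
  set A := (11 + 4 * Real.log (1 + ‖ξ‖) + max 0 (-Real.log ‖ξ‖)) with hA
  have hA0 : 0 ≤ A := soloX_pairConst_nonneg ξ
  have hξ0 : ξ ≠ 0 := soloX_ne_zero_of_transcendental hξ
  simp only [soloX_pieces_deg, soloX_pieces_logHt, soloX_pieces_bank]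
  set F : ℤ[X] := (P : ℤ[X]) with hFdef
  set G : ℤ[X] := (Q : ℤ[X]) with hGdef
  have hF0 : F ≠ 0 := soloX_piece_ne_zero P
  have hG0 : G ≠ 0 := soloX_piece_ne_zero Q
  have hFs : 1 ≤ F.supNorm := soloX_piece_one_le_supNorm P
  have hGs : 1 ≤ G.supNorm := soloX_piece_one_le_supNorm Q
  have hLF : 0 ≤ Real.log F.supNorm := Real.log_nonneg hFs
  have hLG : 0 ≤ Real.log G.supNorm := Real.log_nonneg hGs
  have hlogK : 0 ≤ Real.log ((K : ℝ) + 2) :=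
    Real.log_nonneg (by have := Nat.cast_nonneg (α := ℝ) K; linarith)
  rcases S.eq_empty_or_nonempty with hSe | hSne
  · rw [hSe, Finset.sum_empty]
    have h1 : (0 : ℝ) ≤ (G.natDegree : ℝ) * Real.log F.supNorm := by positivity
    have h2 : (0 : ℝ) ≤ (F.natDegree : ℝ) * Real.log G.supNorm := by positivity
    have h3 : (0 : ℝ) ≤
        A * ((F.natDegree : ℝ) + G.natDegree + ((∅ : Finset ℕ).card : ℕ)) ^ 2 *
          Real.log ((K : ℝ) + 2) := by positivity
    linarith
  -- the data of Proposition 3.1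
  obtain ⟨k₀, hk₀⟩ := hSne
  have hK : 1 ≤ K := (hS k₀ hk₀).1.trans (hS k₀ hk₀).2
  set s := S.card with hs
  have hs0 : 0 < s := Finset.card_pos.mpr ⟨k₀, hk₀⟩
  set n := F.natDegree + G.natDegree + s with hn
  set E := S.image fun k : ℕ => (k : ℂ) * ξ with hE
  have hEcard : E.card = s := soloPT_card_image hξ0 S
  set V : ℂ → ℝ := fun z => max (‖aeval z F‖ / F.supNorm) (‖aeval z G‖ / G.supNorm)
    with hV
  have hVb : ∀ z ∈ E, ‖aeval z F‖ / F.supNorm ≤ V z ∧ ‖aeval z G‖ / G.supNorm ≤ V z :=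
    fun z _ => ⟨le_max_left _ _, le_max_right _ _⟩
  have hcore := soloX_p31_coprime (n := n) hP31 hF0 hG0 (soloX_piece_isPrimitive P)
    (soloX_piece_isPrimitive Q) (soloX_pieces_gcd_eq_one hPQ) hs0 (by omega) (by omega)
    (by omega) hEcard hVb
  -- positivity of the factors
  have hc₁ : 0 < c₁ n s 1 E := soloX_c₁_pos n s E
  have hFpow : 0 < F.supNorm ^ G.natDegree := pow_pos (by linarith) _
  have hGpow : 0 < G.supNorm ^ F.natDegree := pow_pos (by linarith) _
  have hval : ∀ k ∈ S, 0 < ‖aeval ((k : ℂ) * ξ) F‖ ∧ 0 < ‖aeval ((k : ℂ) * ξ) G‖ := fun k hk =>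
    ⟨norm_pos_iff.mpr (soloX_aeval_ne_zero hξ (hS k hk).1 hF0),
      norm_pos_iff.mpr (soloX_aeval_ne_zero hξ (hS k hk).1 hG0)⟩
  have hVpos : ∀ z ∈ E, 0 < V z := by
    intro z hz
    obtain ⟨k, hk, rfl⟩ := Finset.mem_image.mp hz
    exact lt_max_of_lt_left (div_pos (hval k hk).1 (by linarith))
  have hprod : 0 < ∏ z ∈ E, V z := Finset.prod_pos hVpos
  -- logarithms
  have hlog : 0 ≤ Real.log (c₁ n s 1 E) + (G.natDegree : ℝ) * Real.log F.supNorm +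
      (F.natDegree : ℝ) * Real.log G.supNorm + ∑ z ∈ E, Real.log (V z) := by
    have h := Real.log_nonneg hcore
    rw [Real.log_mul (mul_pos (mul_pos hc₁ hFpow) hGpow).ne' hprod.ne',
      Real.log_mul (mul_pos hc₁ hFpow).ne' hGpow.ne', Real.log_mul hc₁.ne' hFpow.ne',
      Real.log_pow, Real.log_pow, Real.log_prod (fun z hz => (hVpos z hz).ne')] at h
    exact h
  have hsumV : ∑ z ∈ E, Real.log (V z) ≤
      -∑ k ∈ S, min (-Real.log ‖aeval ((k : ℂ) * ξ) F‖) (-Real.log ‖aeval ((k : ℂ) * ξ) G‖) := by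
    rw [hE, soloX_sum_cols hξ0, ← Finset.sum_neg_distrib]
    refine Finset.sum_le_sum fun k hk => ?_
    rw [min_neg_neg, neg_neg]
    exact soloX_log_max_div_le (hval k hk).1 (hval k hk).2 hFs hGs
  have hc₁le : Real.log (c₁ n s 1 E) ≤ A * (n : ℝ) ^ 2 * Real.log ((K : ℝ) + 2) :=
    soloX_log_c₁_cols_le hξ0 hK (fun k hk => (hS k hk).2) (by omega)
  have hncast : (n : ℝ) = (F.natDegree : ℝ) + G.natDegree + s := by
    rw [hn]; push_cast; ring
  rw [hncast] at hc₁le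
  linarith

/-! ## (L1) for the pieces -/

/-- **(L1) for the pieces of an enemy sequence** [conditional on Roy's Proposition 3.1].
For `ξ` transcendental, `0 < σ ≤ 1` and Roy data `R n ∈ RoyAdditiveSmall ξ β σ 0 ν n`
(`n ≥ n₀`), the structure `soloX_pieces ξ R` satisfies the entry law with the constant
`A(ξ)`: for a piece `P` NOT dividing `R_ℓ` (`ℓ ≥ n₀`) and columns `S` with `1 ≤ k ≤ ℓ^σ`,
`Σ_{k ∈ S} min (d_P^k, ℓ^ν) ≤ C_P(ℓ) + A(ξ) (ℓ + g_P + |S|)² log (ℓ + 2)` — Proposition 3.1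
for the coprime pair `(P, primPart R_ℓ)` with `‖R_ℓ (kξ)‖ ≤ exp (-ℓ^ν)`. -/
theorem soloX_pieces_entryLaw {ξ : ℂ} (hξ : Transcendental ℚ ξ) (hP31 : prop_3_1)
    {β σ ν : ℝ} (hσ0 : 0 < σ) (hσ1 : σ ≤ 1) {R : ℕ → ℤ[X]} {n₀ : ℕ}
    (hR : ∀ n, n₀ ≤ n → R n ∈ RoyAdditiveSmall ξ β σ 0 ν n) :
    soloX_pieces ξ R ∈ SoloServiceData.entryLaw β σ ν
      (11 + 4 * Real.log (1 + ‖ξ‖) + max 0 (-Real.log ‖ξ‖)) n₀ := by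
  intro P ℓ hℓ hPa S hS
  set A := (11 + 4 * Real.log (1 + ‖ξ‖) + max 0 (-Real.log ‖ξ‖)) with hA
  have hA0 : 0 ≤ A := soloX_pairConst_nonneg ξ
  have hξ0 : ξ ≠ 0 := soloX_ne_zero_of_transcendental hξ
  simp only [SoloServiceData.cost, soloX_pieces_deg, soloX_pieces_logHt, soloX_pieces_bank]
  set F : ℤ[X] := (P : ℤ[X]) with hFdef
  have hF0 : F ≠ 0 := soloX_piece_ne_zero P
  have hFs : 1 ≤ F.supNorm := soloX_piece_one_le_supNorm P
  have hLF : 0 ≤ Real.log F.supNorm := Real.log_nonneg hFs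
  have hℓβ : 0 ≤ (ℓ : ℝ) ^ β := by positivity
  have hlogℓ : 0 ≤ Real.log ((ℓ : ℝ) + 2) :=
    Real.log_nonneg (by have := Nat.cast_nonneg (α := ℝ) ℓ; linarith)
  rcases S.eq_empty_or_nonempty with hSe | hSne
  · rw [hSe, Finset.sum_empty]
    have h1 : (0 : ℝ) ≤ (F.natDegree : ℝ) * (ℓ : ℝ) ^ β := by positivity
    have h2 : (0 : ℝ) ≤ Real.log F.supNorm * ℓ := by positivity
    have h3 : (0 : ℝ) ≤ A * ((ℓ : ℝ) + F.natDegree + ((∅ : Finset ℕ).card : ℕ)) ^ 2 *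
        Real.log ((ℓ : ℝ) + 2) := by positivity
    linarith
  obtain ⟨k₀, hk₀⟩ := hSne
  -- ℓ ≥ 1 and the columns are ≤ ℓ
  have hℓ1 : 1 ≤ ℓ := by
    by_contra h
    have hℓ0 : ℓ = 0 := by omega
    have h1 := (hS k₀ hk₀).2
    rw [hℓ0, Nat.cast_zero, Real.zero_rpow hσ0.ne'] at h1
    have h2 : (1 : ℝ) ≤ k₀ := by exact_mod_cast (hS k₀ hk₀).1
    linarith
  have hcol : ∀ k ∈ S, k ≤ ℓ := by
    intro k hk
    have h1 := (hS k hk).2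
    have h2 : (ℓ : ℝ) ^ σ ≤ (ℓ : ℝ) ^ (1 : ℝ) :=
      Real.rpow_le_rpow_of_exponent_le (by exact_mod_cast hℓ1) hσ1
    rw [Real.rpow_one] at h2
    exact_mod_cast h1.trans h2
  -- the enemy at level ℓ and its primitive part
  have hx := hR ℓ hℓ
  have hx0 : R ℓ ≠ 0 := soloX_small_ne_zero hx
  set G : ℤ[X] := (R ℓ).primPart with hGdef
  have hG0 : G ≠ 0 := primPart_ne_zero _
  have hGp : G.IsPrimitive := isPrimitive_primPart _
  have hGdeg : G.natDegree ≤ ℓ := by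
    rw [hGdef, natDegree_primPart]
    exact_mod_cast soloX_small_natDegree_le hx
  have hGs : 1 ≤ G.supNorm := one_le_supNorm_of_ne_zero hG0
  have hGsx : G.supNorm ≤ (R ℓ).supNorm := soloX_supNorm_primPart_le hx0
  have hlogx : Real.log (R ℓ).supNorm ≤ (ℓ : ℝ) ^ β := soloX_small_log_supNorm_le hx
  have hgcd : gcd F G = 1 := by
    rw [(soloX_piece_irreducible P).gcd_eq_one_iff]
    intro hdvd
    exact hPa ((soloX_pieces_mem_alive_iff_dvd ξ R P hx0).mpr (hdvd.trans (primPart_dvd _)))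
  -- the data of Proposition 3.1
  set s := S.card with hs
  have hs0 : 0 < s := Finset.card_pos.mpr ⟨k₀, hk₀⟩
  have hsℓ : s ≤ ℓ := by
    calc s = S.card := hs
      _ ≤ (Finset.Icc 1 ℓ).card := Finset.card_le_card fun k hk =>
          Finset.mem_Icc.mpr ⟨(hS k hk).1, hcol k hk⟩
      _ = ℓ := by simp
  set n := ℓ + F.natDegree + s with hn
  set E := S.image fun k : ℕ => (k : ℂ) * ξ with hE
  have hEcard : E.card = s := soloPT_card_image hξ0 S
  set V : ℂ → ℝ := fun z => max (‖aeval z F‖ / F.supNorm) (Real.exp (-(ℓ : ℝ) ^ ν)) with hV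
  have hVb : ∀ z ∈ E, ‖aeval z F‖ / F.supNorm ≤ V z ∧ ‖aeval z G‖ / G.supNorm ≤ V z := by
    intro z hz
    refine ⟨le_max_left _ _, le_max_of_le_right ?_⟩
    obtain ⟨k, hk, rfl⟩ := Finset.mem_image.mp hz
    calc ‖aeval ((k : ℂ) * ξ) G‖ / G.supNorm ≤ ‖aeval ((k : ℂ) * ξ) G‖ :=
          div_le_self (norm_nonneg _) hGs
      _ ≤ ‖aeval ((k : ℂ) * ξ) (R ℓ)‖ := soloX_norm_aeval_primPart_le hx0 _
      _ ≤ Real.exp (-(ℓ : ℝ) ^ ν) := soloX_small_norm_aeval_le hx (hS k hk).2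
  have hcore := soloX_p31_coprime (n := n) hP31 hF0 hG0 (soloX_piece_isPrimitive P) hGp hgcd
    hs0 (by omega) (by omega) (by omega) hEcard hVb
  -- positivity of the factors and the two monotone replacements
  have hc₁ : 0 < c₁ n s 1 E := soloX_c₁_pos n s E
  have hFpow : 0 < F.supNorm ^ G.natDegree := pow_pos (by linarith) _
  have hGpow : 0 < G.supNorm ^ F.natDegree := pow_pos (by linarith) _
  have hval : ∀ k ∈ S, 0 < ‖aeval ((k : ℂ) * ξ) F‖ := fun k hk =>
    norm_pos_iff.mpr (soloX_aeval_ne_zero hξ (hS k hk).1 hF0)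
  have hVpos : ∀ z ∈ E, 0 < V z := fun z _ => lt_max_of_lt_right (Real.exp_pos _)
  have hprod : 0 < ∏ z ∈ E, V z := Finset.prod_pos hVpos
  have hFpow' : F.supNorm ^ G.natDegree ≤ F.supNorm ^ ℓ := pow_le_pow_right₀ hFs hGdeg
  have hGpow' : G.supNorm ^ F.natDegree ≤ (R ℓ).supNorm ^ F.natDegree :=
    pow_le_pow_left₀ (by linarith) hGsx _
  have hxs : 0 < (R ℓ).supNorm := by
    have := one_le_supNorm_of_ne_zero hx0; linarith
  have hFpow2 : 0 < F.supNorm ^ ℓ := pow_pos (by linarith) _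
  have hxpow : 0 < (R ℓ).supNorm ^ F.natDegree := pow_pos hxs _
  have hmono : c₁ n s 1 E * F.supNorm ^ G.natDegree * G.supNorm ^ F.natDegree ≤
      c₁ n s 1 E * F.supNorm ^ ℓ * (R ℓ).supNorm ^ F.natDegree :=
    mul_le_mul (mul_le_mul_of_nonneg_left hFpow' hc₁.le) hGpow' hGpow.le
      (mul_pos hc₁ hFpow2).le
  have hcore' : 1 ≤ c₁ n s 1 E * F.supNorm ^ ℓ * (R ℓ).supNorm ^ F.natDegree *
      ∏ z ∈ E, V z := hcore.trans (mul_le_mul_of_nonneg_right hmono hprod.le)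
  have hlog : 0 ≤ Real.log (c₁ n s 1 E) + (ℓ : ℝ) * Real.log F.supNorm +
      (F.natDegree : ℝ) * Real.log (R ℓ).supNorm + ∑ z ∈ E, Real.log (V z) := by
    have h := Real.log_nonneg hcore'
    rw [Real.log_mul (mul_pos (mul_pos hc₁ hFpow2) hxpow).ne' hprod.ne',
      Real.log_mul (mul_pos hc₁ hFpow2).ne' hxpow.ne', Real.log_mul hc₁.ne' hFpow2.ne',
      Real.log_pow, Real.log_pow, Real.log_prod (fun z hz => (hVpos z hz).ne')] at h
    exact h
  have hsumV : ∑ z ∈ E, Real.log (V z) ≤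
      -∑ k ∈ S, min (-Real.log ‖aeval ((k : ℂ) * ξ) F‖) ((ℓ : ℝ) ^ ν) := by
    rw [hE, soloX_sum_cols hξ0, ← Finset.sum_neg_distrib]
    refine Finset.sum_le_sum fun k hk => ?_
    have hq : 0 < ‖aeval ((k : ℂ) * ξ) F‖ / F.supNorm := div_pos (hval k hk) (by linarith)
    have hneg : -min (-Real.log ‖aeval ((k : ℂ) * ξ) F‖) ((ℓ : ℝ) ^ ν) =
        max (Real.log ‖aeval ((k : ℂ) * ξ) F‖) (-(ℓ : ℝ) ^ ν) := by
      rw [← max_neg_neg, neg_neg]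
    rw [hneg]
    show Real.log (max (‖aeval ((k : ℂ) * ξ) F‖ / F.supNorm) (Real.exp (-(ℓ : ℝ) ^ ν))) ≤ _
    rcases le_total (‖aeval ((k : ℂ) * ξ) F‖ / F.supNorm) (Real.exp (-(ℓ : ℝ) ^ ν)) with h | h
    · rw [max_eq_right h, Real.log_exp]
      exact le_max_right _ _
    · rw [max_eq_left h]
      exact (Real.log_le_log hq (div_le_self (norm_nonneg _) hFs)).trans (le_max_left _ _)
  have hdegx : (F.natDegree : ℝ) * Real.log (R ℓ).supNorm ≤ (F.natDegree : ℝ) * (ℓ : ℝ) ^ β :=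
    mul_le_mul_of_nonneg_left hlogx (Nat.cast_nonneg _)
  have hc₁le : Real.log (c₁ n s 1 E) ≤ A * (n : ℝ) ^ 2 * Real.log ((ℓ : ℝ) + 2) :=
    soloX_log_c₁_cols_le hξ0 hℓ1 hcol (by omega)
  have hncast : (n : ℝ) = (ℓ : ℝ) + F.natDegree + s := by
    rw [hn]; push_cast; ring
  rw [hncast] at hc₁le
  linarith

/-- (PAIR) ∧ (L1) packaged for the assembly (F12), with the common constant `A(ξ) ≥ 0`. -/
theorem soloX_pieces_pair_entry {ξ : ℂ} (hξ : Transcendental ℚ ξ) (hP31 : prop_3_1)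
    {β σ ν : ℝ} (hσ0 : 0 < σ) (hσ1 : σ ≤ 1) {R : ℕ → ℤ[X]} {n₀ : ℕ}
    (hR : ∀ n, n₀ ≤ n → R n ∈ RoyAdditiveSmall ξ β σ 0 ν n) :
    0 ≤ 11 + 4 * Real.log (1 + ‖ξ‖) + max 0 (-Real.log ‖ξ‖) ∧
      soloX_pieces ξ R ∈
        SoloServiceData.pairLaw (11 + 4 * Real.log (1 + ‖ξ‖) + max 0 (-Real.log ‖ξ‖)) ∧
      soloX_pieces ξ R ∈ SoloServiceData.entryLaw β σ ν
        (11 + 4 * Real.log (1 + ‖ξ‖) + max 0 (-Real.log ‖ξ‖)) n₀ :=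
  ⟨soloX_pairConst_nonneg ξ, soloX_pieces_pairLaw hξ hP31 R,
    soloX_pieces_entryLaw hξ hP31 hσ0 hσ1 hR⟩

end Summit.Schanuel.Schanuel.Theorems
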